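import Literature.Claims.NS.Bachani2026
import Literature.Analysis.FluidPDE.VorticityCalculus
import Summits.NavierStokesRegularity.NavierStokesRegularity.Theorems.SoloRefuteBledsoe2026Fields
import HarnessLib

/-!
# C147 `Bachani2026` — companion kit 2 (refuter-8 g4): Lemma 6.2 Step 2 on an aligned vortex tube

`Literature.Claims.NS.Bachani2026.Step_L62s2` (Lemma 6.2, Step 2, p.7 l.28–33: «near-alignment
implies large angular gradients … `|∇ω̂|² ≥ c r⁻² ε⁻¹` on a set of positive measure in `B_r`») is
false on a genuine (non-zero, compactly supported, smooth, divergence-free) field: the tube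
`v(y) = (a(y₀) β'(y₁) β(y₂), −a'(y₀) β(y₁) β(y₂), 0)` with `a(s) = s² β(s)` and `β` a plateau bump
(`= 1` on `[-1,1]`) equals the linear shear `(0, −2y₀, 0)` on the core cube `{|yᵢ| < 1}`, so its
vorticity there is the CONSTANT vector `(0,0,−2)`: the direction field `ω̂` is locally constant,
`|∇ω̂|² = 0` on `B(0,½)`, while `W_{1/2}(0) = 4 > 0` and `1 − λ₁ ≤ ε` holds for the admissible
`ε := |1 − λ₁| + 1`. The positive-measure set of Step 2 is empty for every constant `c > 0`.

No statement about Navier–Stokes regularity or blow-up is made or used.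
-/

noncomputable section

open MeasureTheory Set Filter Topology Metric
open scoped ENNReal NNReal ContDiff Topology

namespace Summit.NavierStokesRegularity.NavierStokesRegularity.Theorems.Bachani2026

open Literature.Claims.NS.Bachani2026 Literature.Analysis.FluidPDE
open Summit.NavierStokesRegularity.NavierStokesRegularity.Theorems.Bledsoe2026 (contDiff_coord) -- landed copy (gate dedup rule)

/-! ### A plateau bump on `ℝ` and the profile `a(s) = s² β(s)` -/

/-- Plateau bump on `ℝ`: `= 1` on `[-1,1]`, `= 0` off `(-2,2)`. -/
def pb : ContDiffBump (0 : ℝ) := ⟨1, 2, one_pos, one_lt_two⟩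

/-- The plateau bump is smooth. [folklore] -/
theorem pb_contDiff : ContDiff ℝ ∞ (pb : ℝ → ℝ) := pb.contDiff

/-- The plateau bump is differentiable. [folklore] -/
theorem pb_differentiable : Differentiable ℝ (pb : ℝ → ℝ) :=
  (contDiff_infty_iff_deriv.1 pb_contDiff).1

/-- The derivative of the plateau bump is smooth. [folklore] -/
theorem deriv_pb_contDiff : ContDiff ℝ ∞ (deriv (pb : ℝ → ℝ)) :=
  (contDiff_infty_iff_deriv.1 pb_contDiff).2

/-- The derivative of the plateau bump is differentiable. [folklore] -/
theorem deriv_pb_differentiable : Differentiable ℝ (deriv (pb : ℝ → ℝ)) :=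
  (contDiff_infty_iff_deriv.1 deriv_pb_contDiff).1

/-- `β = 1` on `[-1,1]`. [folklore] -/
theorem pb_one {s : ℝ} (hs : |s| ≤ 1) : pb s = 1 :=
  pb.one_of_mem_closedBall (by rw [Metric.mem_closedBall, Real.dist_eq, sub_zero]; exact hs)

/-- `β = 0` off `(-2,2)`. [folklore] -/
theorem pb_zero {s : ℝ} (hs : 2 ≤ |s|) : pb s = 0 :=
  pb.zero_of_le_dist (by rw [Real.dist_eq, sub_zero]; exact hs)

/-- `β = 1` near every point of the open core `|s| < 1`. [folklore] -/
theorem pb_eventually_one {s : ℝ} (hs : |s| < 1) : (pb : ℝ → ℝ) =ᶠ[𝓝 s] fun _ => (1 : ℝ) := by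
  have ho : IsOpen {t : ℝ | |t| < 1} := isOpen_lt continuous_abs continuous_const
  filter_upwards [ho.mem_nhds hs] with t ht using pb_one (le_of_lt ht)

/-- `β = 0` near every point with `|s| > 2`. [folklore] -/
theorem pb_eventually_zero {s : ℝ} (hs : 2 < |s|) : (pb : ℝ → ℝ) =ᶠ[𝓝 s] fun _ => (0 : ℝ) := by
  have ho : IsOpen {t : ℝ | 2 < |t|} := isOpen_lt continuous_const continuous_abs
  filter_upwards [ho.mem_nhds hs] with t ht using pb_zero (le_of_lt ht)

/-- `β' = 0` on the open core. [folklore] -/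
theorem deriv_pb_core {s : ℝ} (hs : |s| < 1) : deriv (pb : ℝ → ℝ) s = 0 := by
  rw [(pb_eventually_one hs).deriv_eq]; exact deriv_const s 1

/-- `β' = 0` for `|s| > 2`. [folklore] -/
theorem deriv_pb_far {s : ℝ} (hs : 2 < |s|) : deriv (pb : ℝ → ℝ) s = 0 := by
  rw [(pb_eventually_zero hs).deriv_eq]; exact deriv_const s 0

/-- The profile `a(s) = s² β(s)`: `= s²` on the core `|s| < 1`, `= 0` for `|s| > 2`. -/
def prof (s : ℝ) : ℝ := s ^ 2 * pb s

/-- The profile is smooth. [folklore] -/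
theorem prof_contDiff : ContDiff ℝ ∞ prof := (contDiff_id.pow 2).mul pb_contDiff

/-- Product rule for the profile: `a'(s) = 2sβ(s) + s²β'(s)`. [folklore] -/
theorem hasDerivAt_prof (s : ℝ) :
    HasDerivAt prof (2 * s * pb s + s ^ 2 * deriv (pb : ℝ → ℝ) s) s := by
  have h1 : HasDerivAt (fun t : ℝ => t ^ 2) (2 * s) s := by
    simpa using hasDerivAt_pow 2 s
  exact h1.mul (pb_differentiable s).hasDerivAt

/-- `a'(s) = 2sβ(s) + s²β'(s)`. [folklore] -/
theorem deriv_prof (s : ℝ) : deriv prof s = 2 * s * pb s + s ^ 2 * deriv (pb : ℝ → ℝ) s :=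
  (hasDerivAt_prof s).deriv

/-- The profile is differentiable. [folklore] -/
theorem prof_differentiable : Differentiable ℝ prof := fun s => (hasDerivAt_prof s).differentiableAt

/-- `a'` is smooth. [folklore] -/
theorem deriv_prof_contDiff : ContDiff ℝ ∞ (deriv prof) :=
  (contDiff_infty_iff_deriv.1 prof_contDiff).2

/-- `a'` is differentiable. [folklore] -/
theorem deriv_prof_differentiable : Differentiable ℝ (deriv prof) :=
  (contDiff_infty_iff_deriv.1 deriv_prof_contDiff).1

/-- `a = 0` for `|s| > 2`. [folklore] -/
theorem prof_far {s : ℝ} (hs : 2 < |s|) : prof s = 0 := by rw [prof, pb_zero hs.le, mul_zero]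

/-- `a'(s) = 2s` on the core. [folklore] -/
theorem deriv_prof_core {s : ℝ} (hs : |s| < 1) : deriv prof s = 2 * s := by
  rw [deriv_prof, pb_one hs.le, deriv_pb_core hs]; ring

/-- `a' = 0` for `|s| > 2`. [folklore] -/
theorem deriv_prof_far {s : ℝ} (hs : 2 < |s|) : deriv prof s = 0 := by
  rw [deriv_prof, pb_zero hs.le, deriv_pb_far hs]; ring

/-! ### The tube field -/

/-- The derivative of a coordinate function is the coordinate projection. [folklore] -/
theorem hasFDerivAt_coord (i : Fin 3) (y : E3) :
    HasFDerivAt (fun y : E3 => y i) (EuclideanSpace.proj i : E3 →L[ℝ] ℝ) y :=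
  (EuclideanSpace.proj i : E3 →L[ℝ] ℝ).hasFDerivAt

/-- `e₀`, `e₁`. -/
def e0 : E3 := EuclideanSpace.single 0 1
/-- `e₁`. -/
def e1 : E3 := EuclideanSpace.single 1 1

/-- first coefficient `a(y₀) β'(y₁) β(y₂)` -/
def cf0 (y : E3) : ℝ := prof (y 0) * deriv (pb : ℝ → ℝ) (y 1) * pb (y 2)

/-- second coefficient `a'(y₀) β(y₁) β(y₂)` -/
def cf1 (y : E3) : ℝ := deriv prof (y 0) * pb (y 1) * pb (y 2)

/-- **The aligned tube** `v = (a(y₀)β'(y₁)β(y₂), −a'(y₀)β(y₁)β(y₂), 0)`. -/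
def tube (y : E3) : E3 := cf0 y • e0 - cf1 y • e1

/-- The first coefficient is smooth. [folklore] -/
theorem cf0_contDiff : ContDiff ℝ ∞ cf0 :=
  ((prof_contDiff.comp (contDiff_coord 0)).mul (deriv_pb_contDiff.comp (contDiff_coord 1))).mul
    (pb_contDiff.comp (contDiff_coord 2))

/-- The second coefficient is smooth. [folklore] -/
theorem cf1_contDiff : ContDiff ℝ ∞ cf1 :=
  ((deriv_prof_contDiff.comp (contDiff_coord 0)).mul (pb_contDiff.comp (contDiff_coord 1))).mul
    (pb_contDiff.comp (contDiff_coord 2))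

/-- The tube is smooth. -/
theorem tube_contDiff : ContDiff ℝ ∞ tube :=
  (cf0_contDiff.smul contDiff_const).sub (cf1_contDiff.smul contDiff_const)

/-- The tube is divergence free: `∂₀(aβ'β) − ∂₁(a'ββ) = a'β'β − a'β'β = 0`. -/
theorem tube_isDivFree : NSWave0.IsDivFree tube := by
  intro y
  have hf : HasFDerivAt (prof ∘ fun y : E3 => y 0)
      ((deriv prof (y 0)) • (EuclideanSpace.proj 0 : E3 →L[ℝ] ℝ)) y :=
    HasDerivAt.comp_hasFDerivAt y (prof_differentiable (y 0)).hasDerivAt (hasFDerivAt_coord 0 y)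
  have hf1 : HasFDerivAt (deriv prof ∘ fun y : E3 => y 0)
      ((deriv (deriv prof) (y 0)) • (EuclideanSpace.proj 0 : E3 →L[ℝ] ℝ)) y :=
    HasDerivAt.comp_hasFDerivAt y (deriv_prof_differentiable (y 0)).hasDerivAt
      (hasFDerivAt_coord 0 y)
  have hg : HasFDerivAt (deriv (pb : ℝ → ℝ) ∘ fun y : E3 => y 1)
      ((deriv (deriv (pb : ℝ → ℝ)) (y 1)) • (EuclideanSpace.proj 1 : E3 →L[ℝ] ℝ)) y :=
    HasDerivAt.comp_hasFDerivAt y (deriv_pb_differentiable (y 1)).hasDerivAt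
      (hasFDerivAt_coord 1 y)
  have hg1 : HasFDerivAt ((pb : ℝ → ℝ) ∘ fun y : E3 => y 1)
      ((deriv (pb : ℝ → ℝ) (y 1)) • (EuclideanSpace.proj 1 : E3 →L[ℝ] ℝ)) y :=
    HasDerivAt.comp_hasFDerivAt y (pb_differentiable (y 1)).hasDerivAt (hasFDerivAt_coord 1 y)
  have hh : HasFDerivAt ((pb : ℝ → ℝ) ∘ fun y : E3 => y 2)
      ((deriv (pb : ℝ → ℝ) (y 2)) • (EuclideanSpace.proj 2 : E3 →L[ℝ] ℝ)) y :=
    HasDerivAt.comp_hasFDerivAt y (pb_differentiable (y 2)).hasDerivAt (hasFDerivAt_coord 2 y)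
  have h0 : HasFDerivAt cf0 _ y := (hf.mul hg).mul hh
  have h1 : HasFDerivAt cf1 _ y := (hf1.mul hg1).mul hh
  have hT : HasFDerivAt tube _ y := (h0.smul_const e0).sub (h1.smul_const e1)
  rw [NSWave0.divergence, hT.fderiv, LinearMap.trace_eq_sum_inner _ (EuclideanSpace.basisFun (Fin 3) ℝ)]
  simp [e0, e1, EuclideanSpace.inner_single_left]
  ring

/-- Outside the cube `{|yᵢ| ≤ 2}` the tube vanishes. -/
theorem tube_eq_zero_of_far {y : E3} (hy : 2 < |y 0| ∨ 2 < |y 1| ∨ 2 < |y 2|) : tube y = 0 := by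
  rcases hy with h | h | h
  · simp [tube, cf0, cf1, prof_far h, deriv_prof_far h]
  · simp [tube, cf0, cf1, pb_zero h.le, deriv_pb_far h]
  · simp [tube, cf0, cf1, pb_zero h.le]

/-- `‖y‖ > 4 ⇒` some coordinate exceeds `2` in absolute value. -/
theorem exists_coord_of_norm {y : E3} (hy : 4 < ‖y‖) : 2 < |y 0| ∨ 2 < |y 1| ∨ 2 < |y 2| := by
  by_contra h
  simp only [not_or, not_lt] at h
  obtain ⟨h0, h1, h2⟩ := h
  have hn : ‖y‖ ^ 2 = |y 0| ^ 2 + |y 1| ^ 2 + |y 2| ^ 2 := by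
    rw [EuclideanSpace.norm_eq, Real.sq_sqrt (Finset.sum_nonneg fun i _ => sq_nonneg _),
      Fin.sum_univ_three]
    simp [Real.norm_eq_abs]
  nlinarith [mul_self_le_mul_self (abs_nonneg _) h0, mul_self_le_mul_self (abs_nonneg _) h1,
    mul_self_le_mul_self (abs_nonneg _) h2, norm_nonneg y]

/-- The tube is compactly supported. -/
theorem tube_hasCompactSupport : HasCompactSupport tube := by
  refine HasCompactSupport.intro (isCompact_closedBall (0 : E3) 4) fun y hy => ?_
  rw [Metric.mem_closedBall, dist_zero_right, not_le] at hy
  exact tube_eq_zero_of_far (exists_coord_of_norm hy)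

/-- The tube has finite enstrophy `∫ |curl v|² < ∞` (continuous, compactly supported vorticity). -/
theorem tube_enstrophy_lt_top : (∫⁻ y, ‖curl tube y‖ₑ ^ 2) < ⊤ := by
  have hc : Continuous (curl tube) := continuous_curl (tube_contDiff.of_le (by norm_cast))
  have hs : HasCompactSupport (curl tube) := hasCompactSupport_curl tube_hasCompactSupport
  have hs2 : HasCompactSupport (fun y => ‖curl tube y‖ ^ 2) := by
    refine hs.comp_left (g := fun w : E3 => ‖w‖ ^ 2) ?_
    simp
  have hi : Integrable (fun y => ‖curl tube y‖ ^ 2) :=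
    (hc.norm.pow 2).integrable_of_hasCompactSupport hs2
  have h := hi.hasFiniteIntegral
  rw [HasFiniteIntegral] at h
  refine lt_of_le_of_lt (le_of_eq ?_) h
  refine lintegral_congr fun y => ?_
  rw [← ofReal_norm, ← ofReal_norm, norm_pow, norm_norm, ENNReal.ofReal_pow (norm_nonneg _)]


/-! ### The core: on the cube `{|yᵢ| < 1}` the tube is the linear shear `(0, −2y₀, 0)` -/

/-- The open core cube. -/
def core : Set E3 := {y | |y 0| < 1} ∩ ({y | |y 1| < 1} ∩ {y | |y 2| < 1})

/-- The core cube is open. [folklore] -/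
theorem isOpen_core : IsOpen core := by
  have h : ∀ i : Fin 3, IsOpen {y : E3 | |y i| < 1} := fun i =>
    isOpen_lt (continuous_abs.comp (EuclideanSpace.proj i : E3 →L[ℝ] ℝ).continuous) continuous_const
  exact (h 0).inter ((h 1).inter (h 2))

/-- `B(0,½)` lies in the core cube. [folklore] -/
theorem ball_subset_core : Metric.ball (0 : E3) (1 / 2) ⊆ core := by
  intro y hy
  rw [Metric.mem_ball, dist_zero_right] at hy
  have h : ∀ i, |y i| < 1 := fun i => by
    have hi := PiLp.norm_apply_le y i
    rw [Real.norm_eq_abs] at hi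
    linarith
  exact ⟨h 0, h 1, h 2⟩

/-- On the core the tube is the shear `y ↦ (−2 y₀) e₁`. -/
theorem tube_eq_shear {y : E3} (hy : y ∈ core) : tube y = (-2 * y 0) • e1 := by
  obtain ⟨h0, h1, h2⟩ := hy
  simp only [mem_setOf_eq] at h0 h1 h2
  rw [tube, cf0, cf1, deriv_pb_core h1, pb_one h1.le, pb_one h2.le, deriv_prof_core h0]
  simp [neg_smul]

/-- Near a core point the tube agrees with the shear. [folklore] -/
theorem tube_eventuallyEq {y : E3} (hy : y ∈ core) :
    tube =ᶠ[𝓝 y] fun z => (-2 * z 0) • e1 := by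
  filter_upwards [isOpen_core.mem_nhds hy] with z hz using tube_eq_shear hz

/-- Derivative of the shear `z ↦ (−2 z₀) e₁`. [folklore] -/
theorem hasFDerivAt_shear (y : E3) :
    HasFDerivAt (fun z : E3 => (-2 * z 0) • e1)
      (((-2 : ℝ) • (EuclideanSpace.proj 0 : E3 →L[ℝ] ℝ)).smulRight e1) y :=
  ((hasFDerivAt_coord 0 y).const_mul (-2)).smul_const e1

/-- `D(tube)(y) = (−2 dy₀) ⊗ e₁` on the core. [folklore] -/
theorem fderiv_tube {y : E3} (hy : y ∈ core) :
    fderiv ℝ tube y = ((-2 : ℝ) • (EuclideanSpace.proj 0 : E3 →L[ℝ] ℝ)).smulRight e1 := by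
  rw [(tube_eventuallyEq hy).fderiv_eq]; exact (hasFDerivAt_shear y).fderiv

/-- The constant core vorticity `(0,0,−2)`. -/
def ωc : E3 := (-2 : ℝ) • EuclideanSpace.single 2 1

/-- `‖(0,0,−2)‖ = 2`. [folklore] -/
theorem norm_ωc : ‖ωc‖ = 2 := by
  rw [ωc, norm_smul]; simp

/-- **On the core the vorticity is the constant vector `(0,0,−2)`** (aligned with `e₃`). -/
theorem curl_tube {y : E3} (hy : y ∈ core) : curl tube y = ωc := by
  ext i
  fin_cases i <;> simp [curl, fderiv_tube hy, ωc, e1]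

/-- **`|∇ω̂|² = 0` on the core**: the direction field is locally constant there. -/
theorem dirGradSq_tube {y : E3} (hy : y ∈ core) : dirGradSq (curl tube) y = 0 := by
  unfold dirGradSq
  split_ifs with h
  · rfl
  · have hev : dir (curl tube) =ᶠ[𝓝 y] fun _ => ‖ωc‖⁻¹ • ωc := by
      filter_upwards [isOpen_core.mem_nhds hy] with z hz
      rw [dir, curl_tube hz]
    simp [hev.fderiv_eq]

/-- **The local enstrophy weight at the origin, scale `½`, is `4 > 0`** (any mollifier). -/
theorem weight_tube (ρ : Mollifier) : weight ρ (1 / 2) (curl tube) 0 = 4 := by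
  rw [weight]
  have h : (fun y => ρ.ρ (1 / 2) (0 - y) * ‖curl tube y‖ ^ 2) =
      fun y => ρ.ρ (1 / 2) (0 - y) * 4 := by
    funext y
    by_cases hy : (1 / 2 : ℝ) ≤ ‖(0 : E3) - y‖
    · rw [ρ.support _ (by norm_num) _ hy, zero_mul, zero_mul]
    · have hyb : y ∈ Metric.ball (0 : E3) (1 / 2) := by
        rw [Metric.mem_ball, dist_zero_right]
        rw [zero_sub, norm_neg] at hy
        exact lt_of_not_ge hy
      rw [curl_tube (ball_subset_core hyb), norm_ωc]; norm_num
  rw [h, integral_mul_const, integral_sub_left_eq_self (ρ.ρ (1 / 2)) volume (0 : E3),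
    ρ.mass _ (by norm_num)]
  norm_num

/-! ### Lemma 6.2 Step 2 fails on the tube -/

/-- **`¬ Step_L62s2` (Lemma 6.2, Step 2, p.7 l.28–33)**: for every candidate constant `c > 0`, at
the standard mollifier, scale `r = ½`, centre `x = 0` and `ε := |1 − λ₁| + 1`, the tube satisfies
every hypothesis (`C^∞`, divergence free, finite enstrophy, `W > 0`, `1 − λ₁ ≤ ε`) while
`|∇ω̂|² ≡ 0` on `B(0,½)`, so the positive-measure set is empty. [cite: Bachani2026, Lemma 6.2 Step 2 p.7 l.28–33] -/
theorem not_Step_L62s2 : ¬ Step_L62s2 := by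
  rintro ⟨c, hc, H⟩
  obtain ⟨ε, hε, hle⟩ : ∃ ε : ℝ, 0 < ε ∧
      1 - lam1 (alignTensor stdMollifier (1 / 2) (curl tube) 0) ≤ ε :=
    ⟨|1 - lam1 (alignTensor stdMollifier (1 / 2) (curl tube) 0)| + 1, by positivity,
      (le_abs_self _).trans (le_add_of_nonneg_right zero_le_one)⟩
  have hw : 0 < weight stdMollifier (1 / 2) (curl tube) 0 := by rw [weight_tube]; norm_num
  have h := H stdMollifier (1 / 2) (by norm_num) tube tube_contDiff tube_isDivFree
    tube_enstrophy_lt_top 0 ε hε hw hle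
  have key : ∀ y : E3, ¬ (y ∈ Metric.ball (0 : E3) (1 / 2) ∧
      c * (1 / 2 : ℝ)⁻¹ ^ 2 * ε⁻¹ ≤ dirGradSq (curl tube) y) := by
    rintro y ⟨hy, hle'⟩
    rw [dirGradSq_tube (ball_subset_core hy)] at hle'
    have : 0 < c * (1 / 2 : ℝ)⁻¹ ^ 2 * ε⁻¹ := by positivity
    linarith
  have hset : {y : E3 | y ∈ Metric.ball (0 : E3) (1 / 2) ∧
      c * (1 / 2 : ℝ)⁻¹ ^ 2 * ε⁻¹ ≤ dirGradSq (curl tube) y} = ∅ :=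
    Set.ext fun y => ⟨fun hy => (key y hy).elim, fun hy => hy.elim⟩
  rw [hset, measure_empty] at h
  exact lt_irrefl _ h

end Summit.NavierStokesRegularity.NavierStokesRegularity.Theorems.Bachani2026

-- WHAT THIS IS NOT: not a claim about NS regularity or blow-up; not a claim about any author beyond the
-- typed locator.
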